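import Summits.BirchSwinnertonDyer.BirchSwinnertonDyer.Theorems.Rank1ResidualX1Isogeny
import Literature.NumberTheory.EllipticCurves.ShaPrimaryIsogenyProofs
import Literature.GroupTheory.FiniteAbelian.AlternatingPairing
import Literature.NumberTheory.EllipticCurves.BSDShaProofs
import HarnessLib

/-!
# `S-SUB` is a theorem: the NONEMPTY classes of a second `φ`-descent form a subgroup of SQUARE
# order (cell `b2b-bsdres`, CLASS-CLOSURE instrument builder 4 = seat cc-eng-4, GEN 104;
# instrument B-24, implementation 2 `phisel3`)

HONEST FRAMING (cell `b2b-bsdres`, run/shared/lean/b2b/bsd-rank1-residual/, verbatim in every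
file): the goal of the cell is to DELETE the COMBINATION-SHAPED residual classes of the
Birch–Swinnerton-Dyer formula for ALL analytic-rank `≤ 1` elliptic curves over `ℚ` — "full BSD
formula for every rank `≤ 1` curve in class `C`" assembled STRICTLY from published theorems — so
that the rank-`≤ 1` remainder becomes exactly the CONSTRUCTION-SHAPED classes, which are TYPED
(missing-input `Prop`s), NOT attempted. This is not "finishing BSD". THIS FILE is a class-free TOOL
file (finite-abelian-group algebra, then the tree's `Ш(φ)` with the ONE-CURVE Cassels–Tate fact as
a DISPLAYED binder); THEOREMS ONLY (no definition, no named fact, no `sorry`); it asserts nothing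
about any particular curve, closes no item, books nothing, moves no RESIDUAL-MAP mark.

## What this file records

Companion of `SecondDescent/PhiCoveringDescentCertificate.lean` (the `phisel3` READING of
`class-closure/eng-4/b24i2/DESIGN-B24-IMPL2-v0.md` §(2)(g), Cassels–Tate FREE) and of
`SecondDescent/DualPairRadical.lean` (AGREE and `LINES = one` via the pairing on `Ш(W′)`: §1 algebra,
§2 = its Part 2 on `Ш`). Same setting: a dual pair `φ : W → W′`, `ψ : W′ → W` of degree `p`,
`Φ = Ш(φ)`,
`Ψ = Ш(ψ)`; the engine tests, for every non-trivial class `x` of `ker Ψ = Ш(W′)[ψ]` (modulo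
Mordell–Weil: "LINES"), whether the `φ`-Selmer set of the covering `C_x` is EMPTY, i.e.
(Creutz–Miller, J. Algebra 372 (2012) Lemma 2.3, printed, cited, not restated) whether
`x ∉ range Φ`. The design's control `S-SUB` says: the NONEMPTY classes together with `0` must form
a SUBSPACE (`= Φ(Ш(W)[p])`, companion file) and, for `dim ker Ψ = 2`, their number is `0` or `all`
"by squareness" — a NONEMPTY count of exactly one line is withheld as `UNCERTIFIED(S-SUB)`. This
file makes the squareness half a kernel statement, using ONLY the pairing on `Ш(W)` (the curve
being descended), never the pairing on `Ш(W′)` and never the functoriality of the two pairings: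

* §1 (pure algebra; `Φ : A → B` injective, `Ψ : B → A`, `Ψ Φ = p`; `A` FINITE with a bi-additive
  ALTERNATING NON-DEGENERATE pairing `b` into `Q`, `Q[p] ↪ 𝔽_p`; nothing assumed on `B`):
  **`exists_natCard_ker_inf_range_eq_pow_two_mul`** — `#(ker Ψ ⊓ range Φ) = p^(2k)` (the tree's
  even-`p`-rank theorem `exists_natCard_torsionBy_eq_pow_two_mul` for `A`, transported along
  `ker Ψ ⊓ range Φ = Φ(A[p])` — the companion's identity, re-derived inline: this leaf imports
  neither companion); for `#ker Ψ = p²`: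
  **`natCard_ker_inf_range_eq_one_or_eq_sq`** (`∈ {1, p²}`),
  **`ker_inf_range_eq_bot_or_ker_le_range`** (NONE or ALL),
  **`ker_le_range_of_one_nonempty`** (ONE non-trivial NONEMPTY class ⇒ EVERY class NONEMPTY — so a
  NONEMPTY count of one line out of `p + 1` contradicts the published facts: an `UNCERTIFIED(S-SUB)`
  row can only be an engine defect, exactly as a two-engine DISAGREE), and
  **`forall_nsmul_eq_zero_of_one_empty_sq`** (ONE EMPTY class ⇒ `A[p] = 0` — the `LINES = one`
  reading again, now from the pairing on `A`; cf. `forall_nsmul_eq_zero_of_one_empty`, which uses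
  the pairing on `B = Ш(W′)` instead).
* §2: the same on the tree's `Ш` along a dual pair over a number field, `Ш(W)` finite.
* §3: over `ℚ`, with the instrument's binders: `hGZK` (Gross–Zagier–Kolyvagin: `Ш(W)` finite at
  `r_an(W) ≤ 1`) and the ONE-CURVE Cassels–Tate fact `hCT : exists_casselsTate_pairing (K := ℚ)`
  (Silverman *AEC* X.4.14: alternating, kernel = divisible elements = `0` here) —
  **`exists_natCard_sha_ker_inf_range_eq_pow_two_mul_of_casselsTate`** (`S-SUB` at the rows) and the
  class-free END **`bsdp_of_shaMap_injective_of_one_phiCovering_empty_sq`** for the `LINES = one`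
  mode, which needs neither `Ш(W′)` finite nor the adjointness of the two pairings (lighter displayed
  binders than an END through `DualPairRadical`'s
  `sha_torsion_eq_zero_of_shaMap_injective_of_one_phiCovering_empty`, which needs BOTH `Ш` finite and
  the ADJOINT fact `exists_casselsTate_pairing_adjoint`).

References (context only): Creutz–Miller, J. Algebra 372 (2012) Lemma 2.3, Rem. 2.4, Rem. 7.1;
Cassels, J. reine angew. Math. 211 (1962) (order of `Ш` a square); Silverman *AEC* Thm. X.4.14
[SilvermanAEC2009]; Milne *ADT* I Lemma 7.1(b) [MilneADT2006]; Miller, LMS J. Comput. Math. 14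
(2011) Def. 1.1 [Miller2011LMS]; cell files `class-closure/eng-4/b24i2/DESIGN-B24-IMPL2-v0.md`
§(2)(g) (`S-SUB`), `class-closure/STRUCTURE-cc.md` K-CC-2.
-/

set_option autoImplicit false

noncomputable section

open scoped Classical
open scoped AddSubgroup

open WeierstrassCurve Literature.GroupTheory.FiniteAbelian Literature.NumberTheory.EllipticCurves
  Literature.NumberTheory.EllipticCurves.Rank1Residual

universe u

namespace Summit.BirchSwinnertonDyer.Rank1Residual.SecondDescent.PhiCovering

/-! ### §1 Pure algebra: the NONEMPTY classes have square order -/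

section Algebra

variable {A B : Type*} [AddCommGroup A] [AddCommGroup B] (Φ : A →+ B) (Ψ : B →+ A)
  {Q : Type*} [AddCommGroup Q] (p : ℕ) [hp : Fact p.Prime]

/-- **`S-SUB` squareness: `#(ker Ψ ⊓ range Φ) = p^(2k)`.** For homomorphisms `Φ : A → B`,
`Ψ : B → A` with `Ψ (Φ a) = p • a` and `Φ` INJECTIVE, where the finite group `A` carries a
bi-additive alternating non-degenerate pairing `b` with values in `Q`, `Q[p] ↪ 𝔽_p`: the subgroup
`ker Ψ ⊓ range Φ` (the NONEMPTY classes together with `0`) has order an EVEN power of `p` — it is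
`Φ(A[p]) ≅ A[p]` (the companion's `natCard_ker_inf_range_eq_natCard_torsionBy`, re-derived
inline so that this leaf imports only built modules) and `#A[p] = p^(2k)`
(`exists_natCard_torsionBy_eq_pow_two_mul`: a finite group with a non-degenerate alternating
pairing has even `p`-rank). Nothing is assumed on `B`. -/
theorem exists_natCard_ker_inf_range_eq_pow_two_mul [Finite A] (ι : Q[(p : ℤ)] →+ ZMod p)
    (hι : Function.Injective ι) (b : A →+ A →+ Q) (halt : ∀ x, b x x = 0)
    (hnd : ∀ x, (∀ y, b x y = 0) → x = 0) (hΨΦ : ∀ a, Ψ (Φ a) = p • a)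
    (hinj : Function.Injective Φ) :
    ∃ k : ℕ, Nat.card ↥(Ψ.ker ⊓ Φ.range) = p ^ (2 * k) := by
  -- `ker Ψ ⊓ range Φ = Φ(A[p])` (as in the companion's `ker_inf_range_eq_map_torsionBy`)
  have hmap : Ψ.ker ⊓ Φ.range = (A[(p : ℤ)]).map Φ := by
    ext x
    simp only [AddSubgroup.mem_inf, AddMonoidHom.mem_ker, AddMonoidHom.mem_range,
      AddSubgroup.mem_map]
    constructor
    · rintro ⟨hx, a, rfl⟩
      exact ⟨a, by rw [AddSubgroup.torsionBy.nsmul_iff, ← hΨΦ a]; exact hx, rfl⟩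
    · rintro ⟨a, ha, rfl⟩
      exact ⟨by rw [hΨΦ a]; exact AddSubgroup.torsionBy.nsmul_iff.mp ha, a, rfl⟩
  rw [hmap, AddSubgroup.card_map_of_injective hinj]
  exact exists_natCard_torsionBy_eq_pow_two_mul p ι hι A b halt hnd

/-- **For `#ker Ψ = p²` the NONEMPTY count is `0` or `all`: `#(ker Ψ ⊓ range Φ) ∈ {1, p²}`**
(an even power of `p` dividing `p²`). For the instrument (`p = 3`, `dim Ш(Ê)[φ̂] = 2` modulo
Mordell–Weil): `0` or `4` NONEMPTY lines, never `1`. -/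
theorem natCard_ker_inf_range_eq_one_or_eq_sq [Finite A] (ι : Q[(p : ℤ)] →+ ZMod p)
    (hι : Function.Injective ι) (b : A →+ A →+ Q) (halt : ∀ x, b x x = 0)
    (hnd : ∀ x, (∀ y, b x y = 0) → x = 0) (hΨΦ : ∀ a, Ψ (Φ a) = p • a)
    (hinj : Function.Injective Φ) (hcardH : Nat.card Ψ.ker = p ^ 2) :
    Nat.card ↥(Ψ.ker ⊓ Φ.range) = 1 ∨ Nat.card ↥(Ψ.ker ⊓ Φ.range) = p ^ 2 := by
  obtain ⟨k, hk⟩ := exists_natCard_ker_inf_range_eq_pow_two_mul Φ Ψ p ι hι b halt hnd hΨΦ hinj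
  have hdvd : p ^ (2 * k) ∣ p ^ 2 := by
    rw [← hk, ← hcardH]
    exact AddSubgroup.card_dvd_of_le inf_le_left
  have hk1 : k ≤ 1 := by
    have h2k : 2 * k ≤ 2 := (Nat.pow_dvd_pow_iff_le_right hp.out.one_lt).mp hdvd
    omega
  interval_cases k
  · exact Or.inl (by rw [hk, mul_zero, pow_zero])
  · exact Or.inr (by rw [hk, mul_one])

/-- **NONE or ALL, as subgroups**: for `#ker Ψ = p²`, either `ker Ψ ⊓ range Φ = ⊥` (every
non-trivial class EMPTY: the NONDEG₂ verdict) or `ker Ψ ≤ range Φ` (every class NONEMPTY: the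
C-ZERO shape). -/
theorem ker_inf_range_eq_bot_or_ker_le_range [Finite A] (ι : Q[(p : ℤ)] →+ ZMod p)
    (hι : Function.Injective ι) (b : A →+ A →+ Q) (halt : ∀ x, b x x = 0)
    (hnd : ∀ x, (∀ y, b x y = 0) → x = 0) (hΨΦ : ∀ a, Ψ (Φ a) = p • a)
    (hinj : Function.Injective Φ) (hcardH : Nat.card Ψ.ker = p ^ 2) :
    Ψ.ker ⊓ Φ.range = ⊥ ∨ Ψ.ker ≤ Φ.range := by
  haveI : Finite Ψ.ker :=
    Nat.finite_of_card_ne_zero (by rw [hcardH]; exact pow_ne_zero _ hp.out.ne_zero)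
  rcases natCard_ker_inf_range_eq_one_or_eq_sq Φ Ψ p ι hι b halt hnd hΨΦ hinj hcardH with h | h
  · exact Or.inl (AddSubgroup.eq_bot_of_card_eq _ h)
  · refine Or.inr (inf_eq_left.mp ?_)
    exact AddSubgroup.eq_of_le_of_card_ge inf_le_left (by rw [h, hcardH])

/-- **ONE non-trivial NONEMPTY class forces EVERY class NONEMPTY** (`#ker Ψ = p²`): a second
`φ`-descent returning exactly one NONEMPTY non-Mordell–Weil line (out of `p + 1`) contradicts
`Φ` injective + `A` finite with its alternating non-degenerate pairing — the design's
`UNCERTIFIED(S-SUB)` withholding is, like a two-engine DISAGREE, the signature of an engine defect,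
not of a curve. -/
theorem ker_le_range_of_one_nonempty [Finite A] (ι : Q[(p : ℤ)] →+ ZMod p)
    (hι : Function.Injective ι) (b : A →+ A →+ Q) (halt : ∀ x, b x x = 0)
    (hnd : ∀ x, (∀ y, b x y = 0) → x = 0) (hΨΦ : ∀ a, Ψ (Φ a) = p • a)
    (hinj : Function.Injective Φ) (hcardH : Nat.card Ψ.ker = p ^ 2)
    {x₁ : B} (hx₁ : Ψ x₁ = 0) (hx₁0 : x₁ ≠ 0) (hne : ∃ a, Φ a = x₁) :
    ∀ x, Ψ x = 0 → ∃ a, Φ a = x := by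
  rcases ker_inf_range_eq_bot_or_ker_le_range Φ Ψ p ι hι b halt hnd hΨΦ hinj hcardH with h | h
  · exfalso
    have hmem : x₁ ∈ Ψ.ker ⊓ Φ.range := ⟨AddMonoidHom.mem_ker.mpr hx₁, hne⟩
    rw [h, AddSubgroup.mem_bot] at hmem
    exact hx₁0 hmem
  · intro x hx
    exact h (AddMonoidHom.mem_ker.mpr hx)

/-- **ONE EMPTY class kills the `p`-torsion of `A`** (`#ker Ψ = p²`; the `LINES = one` reading,
Creutz–Miller Remark 7.1, here from the pairing on `A`): if some `x₀ ∈ ker Ψ` is not in `range Φ`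
then the alternative "`ker Ψ ≤ range Φ`" is excluded, so `ker Ψ ⊓ range Φ = ⊥`, and for
`p • a = 0` the element `Φ a` lies in that intersection, whence `Φ a = 0` and `a = 0`. -/
theorem forall_nsmul_eq_zero_of_one_empty_sq [Finite A] (ι : Q[(p : ℤ)] →+ ZMod p)
    (hι : Function.Injective ι) (b : A →+ A →+ Q) (halt : ∀ x, b x x = 0)
    (hnd : ∀ x, (∀ y, b x y = 0) → x = 0) (hΨΦ : ∀ a, Ψ (Φ a) = p • a)
    (hinj : Function.Injective Φ) (hcardH : Nat.card Ψ.ker = p ^ 2)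
    {x₀ : B} (hx₀ : Ψ x₀ = 0) (hempty : ∀ a, Φ a ≠ x₀) :
    ∀ a : A, p • a = 0 → a = 0 := by
  rcases ker_inf_range_eq_bot_or_ker_le_range Φ Ψ p ι hι b halt hnd hΨΦ hinj hcardH with h | h
  · intro a ha
    have hmem : Φ a ∈ Ψ.ker ⊓ Φ.range :=
      AddSubgroup.mem_inf.mpr ⟨AddMonoidHom.mem_ker.mpr (by rw [hΨΦ, ha]), a, rfl⟩
    rw [h, AddSubgroup.mem_bot] at hmem
    exact hinj (by rw [hmem, map_zero])
  · exfalso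
    obtain ⟨a, ha⟩ := h (AddMonoidHom.mem_ker.mpr hx₀)
    exact hempty a ha

end Algebra

/-! ### §2 `Ш` along a dual pair of isogenies, `Ш(W)` finite -/

section Sha

variable {K : Type u} [Field K] [NumberField K] {W W' : WeierstrassCurve K}

/-- **`S-SUB` on `Ш`: `#(ker Ш(ψ) ⊓ range Ш(φ)) = p^(2k)`.** Let `φ : W → W′`, `ψ : W′ → W` be a
dual pair of isogenies of prime degree `p` over a number field (`ψ ∘ φ = [p]`), with `Ш(W)`
FINITE carrying a bi-additive alternating non-degenerate `ℚ/ℤ`-valued pairing `B` (the Cassels–Tate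
pairing of `W`: Silverman *AEC* X.4.14; kernel = divisible elements = `0` in a finite group), and
`Ш(φ)` injective (first-descent datum `Ш(W)[φ] = 0`). Then the classes of `Ш(W′)[ψ]` lying in
`range Ш(φ)` — by Creutz–Miller Lemma 2.3 those whose covering has a NONEMPTY `φ`-Selmer set —
form a subgroup of order `p^(2k)`. Nothing is assumed on `Ш(W′)`.
[cite: SilvermanAEC2009, Thm. X.4.14] [cite: MilneADT2006, Ch. I Lemma 7.1(b) (proof), p. 96] -/
theorem exists_natCard_sha_ker_inf_range_eq_pow_two_mul [Finite W.sha] (φ : Isogeny W W')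
    (ψ : Isogeny W' W) (hψφ : ∀ P : W.geomPoints, ψ (φ P) = (φ.degree : ℤ) • P) {p : ℕ}
    [Fact p.Prime] (hdeg : φ.degree = p) (B : W.sha →+ W.sha →+ AddCircle (1 : ℚ))
    (halt : ∀ x, B x x = 0) (hnd : ∀ x : W.sha, (∀ y, B x y = 0) → x = 0)
    (hinj : Function.Injective
      (shaMap φ.toAddMonoidHom φ.equivariant φ.hasLocalPointsMaps_toAddMonoidHom)) :
    ∃ k : ℕ, Nat.card
      ↥((shaMap ψ.toAddMonoidHom ψ.equivariant ψ.hasLocalPointsMaps_toAddMonoidHom).ker ⊓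
        (shaMap φ.toAddMonoidHom φ.equivariant φ.hasLocalPointsMaps_toAddMonoidHom).range) =
      p ^ (2 * k) := by
  obtain ⟨ι, hι⟩ := exists_circleTorsion_toZMod_injective p
  have hΨΦ : ∀ a : W.sha, shaMap ψ.toAddMonoidHom ψ.equivariant ψ.hasLocalPointsMaps_toAddMonoidHom
      (shaMap φ.toAddMonoidHom φ.equivariant φ.hasLocalPointsMaps_toAddMonoidHom a) = p • a :=
    fun a ↦ by rw [Isogeny.shaMap_shaMap_eq_nsmul φ ψ hψφ, hdeg]
  exact exists_natCard_ker_inf_range_eq_pow_two_mul _ _ p ι hι B halt hnd hΨΦ hinj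

/-- **NONE or ALL on `Ш`** (`#Ш(W′)[ψ] = p²`, `Ш(W)[φ] = 0`, `Ш(W)` finite with its Cassels–Tate
pairing): either no non-zero class of `Ш(W′)[ψ]` lies in `range Ш(φ)` (every non-trivial covering
EMPTY) or every class does (every covering NONEMPTY).
[cite: SilvermanAEC2009, Thm. X.4.14] [cite: MilneADT2006, Ch. I Lemma 7.1(b) (proof), p. 96] -/
theorem sha_ker_inf_range_eq_bot_or_ker_le_range [Finite W.sha] (φ : Isogeny W W')
    (ψ : Isogeny W' W) (hψφ : ∀ P : W.geomPoints, ψ (φ P) = (φ.degree : ℤ) • P) {p : ℕ}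
    [Fact p.Prime] (hdeg : φ.degree = p) (B : W.sha →+ W.sha →+ AddCircle (1 : ℚ))
    (halt : ∀ x, B x x = 0) (hnd : ∀ x : W.sha, (∀ y, B x y = 0) → x = 0)
    (hinj : Function.Injective
      (shaMap φ.toAddMonoidHom φ.equivariant φ.hasLocalPointsMaps_toAddMonoidHom))
    (hcardH : Nat.card
      (shaMap ψ.toAddMonoidHom ψ.equivariant ψ.hasLocalPointsMaps_toAddMonoidHom).ker = p ^ 2) :
    (shaMap ψ.toAddMonoidHom ψ.equivariant ψ.hasLocalPointsMaps_toAddMonoidHom).ker ⊓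
          (shaMap φ.toAddMonoidHom φ.equivariant φ.hasLocalPointsMaps_toAddMonoidHom).range = ⊥ ∨
      (shaMap ψ.toAddMonoidHom ψ.equivariant ψ.hasLocalPointsMaps_toAddMonoidHom).ker ≤
        (shaMap φ.toAddMonoidHom φ.equivariant φ.hasLocalPointsMaps_toAddMonoidHom).range := by
  obtain ⟨ι, hι⟩ := exists_circleTorsion_toZMod_injective p
  have hΨΦ : ∀ a : W.sha, shaMap ψ.toAddMonoidHom ψ.equivariant ψ.hasLocalPointsMaps_toAddMonoidHom
      (shaMap φ.toAddMonoidHom φ.equivariant φ.hasLocalPointsMaps_toAddMonoidHom a) = p • a :=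
    fun a ↦ by rw [Isogeny.shaMap_shaMap_eq_nsmul φ ψ hψφ, hdeg]
  exact ker_inf_range_eq_bot_or_ker_le_range _ _ p ι hι B halt hnd hΨΦ hinj hcardH

/-- **ONE NONEMPTY non-trivial covering forces ALL coverings NONEMPTY on `Ш`** (hypotheses as in
`sha_ker_inf_range_eq_bot_or_ker_le_range`): the `UNCERTIFIED(S-SUB)` shape (exactly one NONEMPTY
non-Mordell–Weil line) cannot occur on a row with `Ш(W)[φ] = 0` and `Ш(W)` finite.
[cite: SilvermanAEC2009, Thm. X.4.14] [cite: MilneADT2006, Ch. I Lemma 7.1(b) (proof), p. 96] -/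
theorem sha_ker_le_range_of_one_phiCovering_nonempty [Finite W.sha] (φ : Isogeny W W')
    (ψ : Isogeny W' W) (hψφ : ∀ P : W.geomPoints, ψ (φ P) = (φ.degree : ℤ) • P) {p : ℕ}
    [Fact p.Prime] (hdeg : φ.degree = p) (B : W.sha →+ W.sha →+ AddCircle (1 : ℚ))
    (halt : ∀ x, B x x = 0) (hnd : ∀ x : W.sha, (∀ y, B x y = 0) → x = 0)
    (hinj : Function.Injective
      (shaMap φ.toAddMonoidHom φ.equivariant φ.hasLocalPointsMaps_toAddMonoidHom))
    (hcardH : Nat.card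
      (shaMap ψ.toAddMonoidHom ψ.equivariant ψ.hasLocalPointsMaps_toAddMonoidHom).ker = p ^ 2)
    {x₁ : W'.sha} (hx₁0 : x₁ ≠ 0)
    (hx₁ : shaMap ψ.toAddMonoidHom ψ.equivariant ψ.hasLocalPointsMaps_toAddMonoidHom x₁ = 0)
    (hne : ∃ z : W.sha,
      shaMap φ.toAddMonoidHom φ.equivariant φ.hasLocalPointsMaps_toAddMonoidHom z = x₁) :
    ∀ x : W'.sha,
      shaMap ψ.toAddMonoidHom ψ.equivariant ψ.hasLocalPointsMaps_toAddMonoidHom x = 0 →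
        ∃ z : W.sha,
          shaMap φ.toAddMonoidHom φ.equivariant φ.hasLocalPointsMaps_toAddMonoidHom z = x := by
  obtain ⟨ι, hι⟩ := exists_circleTorsion_toZMod_injective p
  have hΨΦ : ∀ a : W.sha, shaMap ψ.toAddMonoidHom ψ.equivariant ψ.hasLocalPointsMaps_toAddMonoidHom
      (shaMap φ.toAddMonoidHom φ.equivariant φ.hasLocalPointsMaps_toAddMonoidHom a) = p • a :=
    fun a ↦ by rw [Isogeny.shaMap_shaMap_eq_nsmul φ ψ hψφ, hdeg]
  exact ker_le_range_of_one_nonempty _ _ p ι hι B halt hnd hΨΦ hinj hcardH hx₁ hx₁0 hne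

/-- **`LINES = one` on `Ш` from the pairing on `Ш(W)` alone: one EMPTY class, `#Ш(W′)[ψ] = p²`
and `Ш(W)[φ] = 0` give `Ш(W)[deg φ] = 0`** (`Ш(W)` finite with its Cassels–Tate pairing; nothing on
`Ш(W′)`; cf. `sha_torsion_eq_zero_of_shaMap_injective_of_one_phiCovering_empty`, which uses the
pairing on `Ш(W′)` and the adjointness of the two pairings instead).
[cite: SilvermanAEC2009, Thm. X.4.14] [cite: MilneADT2006, Ch. I Lemma 7.1(b) (proof), p. 96] -/
theorem sha_torsion_eq_zero_of_shaMap_injective_of_one_phiCovering_empty_sq [Finite W.sha]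
    (φ : Isogeny W W') (ψ : Isogeny W' W)
    (hψφ : ∀ P : W.geomPoints, ψ (φ P) = (φ.degree : ℤ) • P) {p : ℕ} [Fact p.Prime]
    (hdeg : φ.degree = p) (B : W.sha →+ W.sha →+ AddCircle (1 : ℚ)) (halt : ∀ x, B x x = 0)
    (hnd : ∀ x : W.sha, (∀ y, B x y = 0) → x = 0)
    (hinj : Function.Injective
      (shaMap φ.toAddMonoidHom φ.equivariant φ.hasLocalPointsMaps_toAddMonoidHom))
    (hcardH : Nat.card
      (shaMap ψ.toAddMonoidHom ψ.equivariant ψ.hasLocalPointsMaps_toAddMonoidHom).ker = p ^ 2)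
    {x₀ : W'.sha}
    (hx₀ : shaMap ψ.toAddMonoidHom ψ.equivariant ψ.hasLocalPointsMaps_toAddMonoidHom x₀ = 0)
    (hempty : ∀ z : W.sha,
      shaMap φ.toAddMonoidHom φ.equivariant φ.hasLocalPointsMaps_toAddMonoidHom z ≠ x₀) :
    ∀ z : W.sha, (φ.degree : ℤ) • z = 0 → z = 0 := by
  obtain ⟨ι, hι⟩ := exists_circleTorsion_toZMod_injective p
  have hΨΦ : ∀ a : W.sha, shaMap ψ.toAddMonoidHom ψ.equivariant ψ.hasLocalPointsMaps_toAddMonoidHom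
      (shaMap φ.toAddMonoidHom φ.equivariant φ.hasLocalPointsMaps_toAddMonoidHom a) = p • a :=
    fun a ↦ by rw [Isogeny.shaMap_shaMap_eq_nsmul φ ψ hψφ, hdeg]
  intro z hz
  have hz' : p • z = 0 := by rw [← hdeg, ← natCast_zsmul]; exact hz
  exact forall_nsmul_eq_zero_of_one_empty_sq _ _ p ι hι B halt hnd hΨΦ hinj hcardH hx₀ hempty z hz'

end Sha

/-! ### §3 Over `ℚ`: `S-SUB` at the instrument's rows and the `LINES = one` END, one-curve
Cassels–Tate only -/

section Rat

/-- **`S-SUB` at the rows.** For elliptic `W, W′/ℚ` with `r_an(W) ≤ 1`, a dual pair of prime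
degree `p` and `Ш(φ)` injective, granted Gross–Zagier–Kolyvagin (`hGZK`: `Ш(W)` finite) and the
ONE-CURVE Cassels–Tate fact (`hCT`, Silverman *AEC* X.4.14: alternating, kernel the divisible
elements, `= 0` since `Ш(W)` is finite — `divisibleElements_eq_bot_of_finite`):
`#(ker Ш(ψ) ⊓ range Ш(φ)) = p^(2k)`. So on every row with `Ш(W₀)[φ] = 0` the number of NONEMPTY
classes modulo Mordell–Weil is an even power of `3` by PUBLISHED facts; per pair, not a
class theorem. [cite: SilvermanAEC2009, Thm. X.4.14] [cite: Miller2011LMS, §1 Def. 1.1] -/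
theorem exists_natCard_sha_ker_inf_range_eq_pow_two_mul_of_casselsTate
    (hGZK : rank_eq_analyticRank_of_analyticRank_le_one)
    (hCT : exists_casselsTate_pairing (K := ℚ)) (W W' : WeierstrassCurve ℚ) [W.IsElliptic]
    [W'.IsElliptic] (p : ℕ) [Fact p.Prime] (hr : W.analyticRank ≤ 1)
    (φ : Isogeny W W') (ψ : Isogeny W' W)
    (hψφ : ∀ P : W.geomPoints, ψ (φ P) = (φ.degree : ℤ) • P) (hdeg : φ.degree = p)
    (hinj : Function.Injective
      (shaMap φ.toAddMonoidHom φ.equivariant φ.hasLocalPointsMaps_toAddMonoidHom)) :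
    ∃ k : ℕ, Nat.card
      ↥((shaMap ψ.toAddMonoidHom ψ.equivariant ψ.hasLocalPointsMaps_toAddMonoidHom).ker ⊓
        (shaMap φ.toAddMonoidHom φ.equivariant φ.hasLocalPointsMaps_toAddMonoidHom).range) =
      p ^ (2 * k) := by
  haveI : Finite W.sha := (hGZK W hr).2
  obtain ⟨B, hBalt, hBker⟩ := hCT W
  have hnd : ∀ x : W.sha, (∀ y, B x y = 0) → x = 0 := fun x hx ↦ by
    have hmem : x ∈ AddSubgroup.divisibleElements W.sha := (hBker x).mp hx
    rwa [divisibleElements_eq_bot_of_finite, AddSubgroup.mem_bot] at hmem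
  exact exists_natCard_sha_ker_inf_range_eq_pow_two_mul φ ψ hψφ hdeg B hBalt hnd hinj

/-- **`BSD(W, p)` from `Ш(W)[φ] = 0`, `#Ш(W′)[ψ] = p²` and ONE EMPTY `φ`-Selmer set, with the
ONE-CURVE Cassels–Tate fact only** (class-free; the `LINES = one` reading). For elliptic `W, W′/ℚ`
with `r_an(W) ≤ 1`, `p ∤ #Ш_an(W)` (`#Ш_an(W) = q`, `ord_p q = 0`), a dual pair of degree `p`,
granted `hGZK` (Gross–Zagier–Kolyvagin) and `hCT : exists_casselsTate_pairing` (Silverman *AEC*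
X.4.14): the certificate "`Ш(φ)` injective, `#ker Ш(ψ) = p²`, some class of `ker Ш(ψ)` not in
`range Ш(φ)`" gives `Ш(W)[p] = 0`
(`sha_torsion_eq_zero_of_shaMap_injective_of_one_phiCovering_empty_sq`), whence `BSDp W p`
(`Typed.bsdp_of_shaAn_unit_of_noPTorsion`). Neither the finiteness of `Ш(W′)` nor the functoriality
of the pairings is used. Per pair; not a class theorem.
[cite: SilvermanAEC2009, Thm. X.4.14] [cite: Miller2011LMS, §1 Def. 1.1] -/
theorem bsdp_of_shaMap_injective_of_one_phiCovering_empty_sq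
    (hGZK : rank_eq_analyticRank_of_analyticRank_le_one)
    (hCT : exists_casselsTate_pairing (K := ℚ)) (W W' : WeierstrassCurve ℚ) [W.IsElliptic]
    [W'.IsElliptic] (p : ℕ) [Fact p.Prime] (hr : W.analyticRank ≤ 1)
    {q : ℚ} (hq : shaAn W = (q : ℂ)) (hv : padicValRat p q = 0)
    (φ : Isogeny W W') (ψ : Isogeny W' W)
    (hψφ : ∀ P : W.geomPoints, ψ (φ P) = (φ.degree : ℤ) • P) (hdeg : φ.degree = p)
    (hinj : Function.Injective
      (shaMap φ.toAddMonoidHom φ.equivariant φ.hasLocalPointsMaps_toAddMonoidHom))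
    (hcardH : Nat.card
      (shaMap ψ.toAddMonoidHom ψ.equivariant ψ.hasLocalPointsMaps_toAddMonoidHom).ker = p ^ 2)
    {x₀ : W'.sha}
    (hx₀ : shaMap ψ.toAddMonoidHom ψ.equivariant ψ.hasLocalPointsMaps_toAddMonoidHom x₀ = 0)
    (hempty : ∀ z : W.sha,
      shaMap φ.toAddMonoidHom φ.equivariant φ.hasLocalPointsMaps_toAddMonoidHom z ≠ x₀) :
    BSDp W p := by
  haveI : Finite W.sha := (hGZK W hr).2
  obtain ⟨B, hBalt, hBker⟩ := hCT W
  have hnd : ∀ x : W.sha, (∀ y, B x y = 0) → x = 0 := fun x hx ↦ by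
    have hmem : x ∈ AddSubgroup.divisibleElements W.sha := (hBker x).mp hx
    rwa [divisibleElements_eq_bot_of_finite, AddSubgroup.mem_bot] at hmem
  refine Typed.bsdp_of_shaAn_unit_of_noPTorsion W p hGZK hr hq hv fun x hx ↦ ?_
  refine sha_torsion_eq_zero_of_shaMap_injective_of_one_phiCovering_empty_sq φ ψ hψφ hdeg B
    hBalt hnd hinj hcardH hx₀ hempty x ?_
  rwa [hdeg]

end Rat

end Summit.BirchSwinnertonDyer.Rank1Residual.SecondDescent.PhiCovering

end
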